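import Summits.QuantumFields.GaugeBoot.TwistedSlabFourLink
import HarnessLib

/-!
# The slab integral: a plaquette observable against one-link class weights on a block of links (gauge-boot, L3 negative supplement; twisted-slab mechanism 3/4)

HONEST FRAMING (cell `pub-gaugeboot`, page 1 of every file): the venture produces certified bounds
on lattice expectations at stated coupling, gauge group, dimension and torus size; NOT a mass gap,
NOT a continuum limit, NOT a string tension; NOT Yang–Mills-summit-bearing (barriers
`FixedCouplingUltralocality`, `PerturbativeInvisibility`). Bookkeeping for the NEGATIVE result of
`TiltedBoxOddAxisRPNegative.lean`.

With the substitution and the elimination step of `TwistedSlabFourLink.lean`: for a continuous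
inversion-invariant class weight `w` with `wAvg ρ w = c • 1`, a block `S` of links, constants
`a, b : Link → G` and four distinct links `t₀, t₁, t₂, t₃ ∈ S`,

* `integral_prod_weight_mul_trace` —
  `∫ ∏_{t∈S} w(Y_t) · tr(K₀ ρ(Y₀⁻¹) K₁ ρ(Y₁⁻¹) K₂ ρ(Y₂) K₃ ρ(Y₃) K₄) dμ = z^{|S|-4} c⁴ tr(K₀K₁K₂K₃K₄)`
  (eliminate the four plaquette variables one at a time; the remaining `|S| - 4` weights give `z` each);
* **`slab_integral`** —
  `∫ Re tr ρ(Y_{t₀} Y_{t₁} Y_{t₂}⁻¹ Y_{t₃}⁻¹) ∏_{t ∈ S} w(a_t Y_t⁻¹ b_t) dμ(Y)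
     = z^{|S| - 4} c⁴ Re tr ρ(b₀ a₀ b₁ a₁ a₂⁻¹ b₂⁻¹ a₃⁻¹ b₃⁻¹)`.
  In the application (`TiltedBoxOddAxisRPNegative.lean`) `S` is the set of links of the layer above a
  twisted slab, `Y₀Y₁Y₂⁻¹Y₃⁻¹` the holonomy of a plaquette in that layer, `a_t, b_t` the frozen
  neighbouring link variables, and the right-hand word is a conjugate of the holonomy of the plaquette
  BELOW it — the slab "transfers" plaquettes vertically with the factor `z^{|S|-4} c⁴ > 0`.

Everything is `[folklore]`.

References: K. Osterwalder, E. Seiler, Ann. Phys. 110 (1978) 440, §2; T. Bröcker, T. tom Dieck,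
GTM 98 (1985), II §4.
-/

noncomputable section

open MeasureTheory Complex
open scoped Matrix ComplexConjugate
open Literature.MathematicalPhysics.QuantumFieldTheory (haarProbability)
open Literature.MathematicalPhysics.QuantumFieldTheory.LatticeRP (integral_mul_eq_of_dependsOn
  integral_comp_eq_of_measurePreserving)
open Literature.RepresentationTheory.CompactGroups

namespace Summit.QuantumFields.GaugeBoot

namespace TwistedSlab

open TiltedRP

variable {A : Type*} [Fintype A] [DecidableEq A] {d N : ℕ}
variable {G : Type*} [Group G] [TopologicalSpace G] [IsTopologicalGroup G] [CompactSpace G]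
  [MeasurableSpace G] [BorelSpace G] [SecondCountableTopology G] (ρ : G →* Matrix (Fin N) (Fin N) ℂ)

/-! ## The slab integral -/

section Slab

variable {w : G → ℝ} (hw : Continuous w) (hinv : ∀ k, w k⁻¹ = w k) {c : ℂ}
  (hc : wAvg ρ w = c • (1 : Matrix (Fin N) (Fin N) ℂ)) (hρ : Continuous ρ)
  (S : Finset (Link A d)) (a b : Link A d → G)
  {t₀ t₁ t₂ t₃ : Link A d} (h₀ : t₀ ∈ S) (h₁ : t₁ ∈ S) (h₂ : t₂ ∈ S) (h₃ : t₃ ∈ S)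
  (h01 : t₀ ≠ t₁) (h02 : t₀ ≠ t₂) (h03 : t₀ ≠ t₃) (h12 : t₁ ≠ t₂) (h13 : t₁ ≠ t₃) (h23 : t₂ ≠ t₃)
include hw hinv hc hρ h₀ h₁ h₂ h₃ h01 h02 h03 h12 h13 h23

/-- **The slab integral after the substitution**: with `Kᵢ` the constant matrices between the
plaquette variables,
`∫ ∏_{t∈S} w(Y_t) · tr(K₀ ρ(Y₀⁻¹) K₁ ρ(Y₁⁻¹) K₂ ρ(Y₂) K₃ ρ(Y₃) K₄) dμ = z^{|S|-4} c⁴ tr(K₀K₁K₂K₃K₄)`.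
[folklore] -/
theorem integral_prod_weight_mul_trace (K₀ K₁ K₂ K₃ K₄ : Matrix (Fin N) (Fin N) ℂ) :
    ∫ Y, (∏ t ∈ S, (w (Y t) : ℂ)) *
        (K₀ * ρ (Y t₀)⁻¹ * K₁ * ρ (Y t₁)⁻¹ * K₂ * ρ (Y t₂) * K₃ * ρ (Y t₃) * K₄).trace
        ∂(productHaar A d G) =
      (∫ k, (w k : ℂ) ∂(haarProbability G)) ^ (S.card - 4) * c ^ 4 * (K₀ * K₁ * K₂ * K₃ * K₄).trace := by
  -- the one-link integrals
  have hφ1 : ∀ x y, ∫ k, (w k : ℂ) * ρ k x y ∂(haarProbability G) = if x = y then c else 0 :=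
    integral_weight_mul_entry ρ hc
  have hφ2 : ∀ x y, ∫ k, (w k : ℂ) * ρ k⁻¹ x y ∂(haarProbability G) = if x = y then c else 0 :=
    integral_weight_mul_entry_inv ρ hc hinv
  have hρi : Continuous fun k : G => ρ k⁻¹ := hρ.comp continuous_inv
  -- peel the four variables: write the product of weights as `w(Y_{t}) * rest`
  set S₀ := (((S.erase t₀).erase t₁).erase t₂).erase t₃ with hS₀
  have hmem : ∀ t, t ∈ S ↔ t = t₀ ∨ t = t₁ ∨ t = t₂ ∨ t = t₃ ∨ t ∈ S₀ := by
    intro t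
    simp only [hS₀, Finset.mem_erase]
    constructor
    · intro ht
      by_cases e0 : t = t₀; · exact Or.inl e0
      by_cases e1 : t = t₁; · exact Or.inr (Or.inl e1)
      by_cases e2 : t = t₂; · exact Or.inr (Or.inr (Or.inl e2))
      by_cases e3 : t = t₃; · exact Or.inr (Or.inr (Or.inr (Or.inl e3)))
      exact Or.inr (Or.inr (Or.inr (Or.inr ⟨e3, e2, e1, e0, ht⟩)))
    · rintro (rfl | rfl | rfl | rfl | h)
      · exact h₀
      · exact h₁
      · exact h₂
      · exact h₃
      · exact h.2.2.2.2
  have hS : S = insert t₀ (insert t₁ (insert t₂ (insert t₃ S₀))) := by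
    ext t; simp only [Finset.mem_insert, hmem]
  have n0 : t₀ ∉ insert t₁ (insert t₂ (insert t₃ S₀)) := by
    simp [hS₀, h01, h02, h03]
  have n1 : t₁ ∉ insert t₂ (insert t₃ S₀) := by simp [hS₀, h12, h13]
  have n2 : t₂ ∉ insert t₃ S₀ := by simp [hS₀, h23]
  have n3 : t₃ ∉ S₀ := by simp [hS₀]
  have hcard : S.card - 4 = S₀.card := by
    rw [hS, Finset.card_insert_of_notMem n0, Finset.card_insert_of_notMem n1,
      Finset.card_insert_of_notMem n2, Finset.card_insert_of_notMem n3]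
    omega
  -- continuity helpers
  have hwY : ∀ t, Continuous fun Y : Config A d G => (w (Y t) : ℂ) :=
    fun t => continuous_ofReal.comp (hw.comp (continuous_apply t))
  have hprod : ∀ T : Finset (Link A d), Continuous fun Y : Config A d G => ∏ u ∈ T, (w (Y u) : ℂ) :=
    fun T => continuous_finsetProd _ fun u _ => hwY u
  have hdepW : ∀ T : Finset (Link A d), DependsOn (fun Y : Config A d G => ∏ u ∈ T, (w (Y u) : ℂ))
      (T : Set _) :=
    fun T Y Y' h => Finset.prod_congr rfl fun u hu => by rw [h u (by simpa using hu)]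
  have hρY : ∀ t, Continuous fun Y : Config A d G => ρ (Y t) := fun t => hρ.comp (continuous_apply t)
  have hρYi : ∀ t, Continuous fun Y : Config A d G => ρ (Y t)⁻¹ :=
    fun t => hρ.comp ((continuous_apply t).inv)
  -- Step 1: eliminate `t₀`
  have hprodS : ∀ Y : Config A d G, ∏ t ∈ S, (w (Y t) : ℂ) =
      (w (Y t₀) : ℂ) * ((w (Y t₁) : ℂ) * ((w (Y t₂) : ℂ) * ((w (Y t₃) : ℂ) * ∏ u ∈ S₀, (w (Y u) : ℂ)))) := by
    intro Y
    rw [hS, Finset.prod_insert n0, Finset.prod_insert n1, Finset.prod_insert n2, Finset.prod_insert n3]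
  simp_rw [hprodS]
  have e1 : ∀ Y : Config A d G,
      (w (Y t₀) : ℂ) * ((w (Y t₁) : ℂ) * ((w (Y t₂) : ℂ) * ((w (Y t₃) : ℂ) * ∏ u ∈ S₀, (w (Y u) : ℂ)))) *
        (K₀ * ρ (Y t₀)⁻¹ * K₁ * ρ (Y t₁)⁻¹ * K₂ * ρ (Y t₂) * K₃ * ρ (Y t₃) * K₄).trace =
      (w (Y t₀) : ℂ) * ((w (Y t₁) : ℂ) * ((w (Y t₂) : ℂ) * ((w (Y t₃) : ℂ) * ∏ u ∈ S₀, (w (Y u) : ℂ)))) *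
        (K₀ * ρ (Y t₀)⁻¹ * (K₁ * ρ (Y t₁)⁻¹ * K₂ * ρ (Y t₂) * K₃ * ρ (Y t₃) * K₄)).trace := by
    intro Y; simp only [Matrix.mul_assoc]
  simp_rw [e1]
  rw [integral_weight_entry_step hw hρi hφ2 t₀ (insert t₁ (insert t₂ (insert t₃ S₀))) n0 K₀
    (fun Y => K₁ * ρ (Y t₁)⁻¹ * K₂ * ρ (Y t₂) * K₃ * ρ (Y t₃) * K₄)
    (fun Y => (w (Y t₁) : ℂ) * ((w (Y t₂) : ℂ) * ((w (Y t₃) : ℂ) * ∏ u ∈ S₀, (w (Y u) : ℂ))))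
    (fun x y => CompactGroup.continuous_entry
      ((((((continuous_const.mul (hρYi t₁)).mul continuous_const).mul
        (hρY t₂)).mul continuous_const).mul (hρY t₃)).mul continuous_const) x y)
    (fun x y Y Y' h => by
      dsimp only
      rw [h t₁ (by simp), h t₂ (by simp), h t₃ (by simp)])
    ((hwY t₁).mul ((hwY t₂).mul ((hwY t₃).mul (hprod S₀))))
    (fun Y Y' h => by
      dsimp only
      rw [h t₁ (by simp), h t₂ (by simp), h t₃ (by simp),
        show (∏ u ∈ S₀, (w (Y u) : ℂ)) = ∏ u ∈ S₀, (w (Y' u) : ℂ) from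
          hdepW S₀ (fun u hu => h u (by simp [hu]))])]
  -- Step 2: eliminate `t₁`
  have e2 : ∀ Y : Config A d G,
      (w (Y t₁) : ℂ) * ((w (Y t₂) : ℂ) * ((w (Y t₃) : ℂ) * ∏ u ∈ S₀, (w (Y u) : ℂ))) *
        (K₀ * (K₁ * ρ (Y t₁)⁻¹ * K₂ * ρ (Y t₂) * K₃ * ρ (Y t₃) * K₄)).trace =
      (w (Y t₁) : ℂ) * ((w (Y t₂) : ℂ) * ((w (Y t₃) : ℂ) * ∏ u ∈ S₀, (w (Y u) : ℂ))) *
        (K₀ * K₁ * ρ (Y t₁)⁻¹ * (K₂ * ρ (Y t₂) * K₃ * ρ (Y t₃) * K₄)).trace := by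
    intro Y; simp only [Matrix.mul_assoc]
  simp_rw [e2]
  rw [integral_weight_entry_step hw hρi hφ2 t₁ (insert t₂ (insert t₃ S₀)) n1 (K₀ * K₁)
    (fun Y => K₂ * ρ (Y t₂) * K₃ * ρ (Y t₃) * K₄)
    (fun Y => (w (Y t₂) : ℂ) * ((w (Y t₃) : ℂ) * ∏ u ∈ S₀, (w (Y u) : ℂ)))
    (fun x y => CompactGroup.continuous_entry
      ((((continuous_const.mul (hρY t₂)).mul continuous_const).mul
        (hρY t₃)).mul continuous_const) x y)
    (fun x y Y Y' h => by dsimp only; rw [h t₂ (by simp), h t₃ (by simp)])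
    ((hwY t₂).mul ((hwY t₃).mul (hprod S₀)))
    (fun Y Y' h => by
      dsimp only
      rw [h t₂ (by simp), h t₃ (by simp),
        show (∏ u ∈ S₀, (w (Y u) : ℂ)) = ∏ u ∈ S₀, (w (Y' u) : ℂ) from
          hdepW S₀ (fun u hu => h u (by simp [hu]))])]
  -- Step 3: eliminate `t₂`
  have e3 : ∀ Y : Config A d G,
      (w (Y t₂) : ℂ) * ((w (Y t₃) : ℂ) * ∏ u ∈ S₀, (w (Y u) : ℂ)) *
        (K₀ * K₁ * (K₂ * ρ (Y t₂) * K₃ * ρ (Y t₃) * K₄)).trace =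
      (w (Y t₂) : ℂ) * ((w (Y t₃) : ℂ) * ∏ u ∈ S₀, (w (Y u) : ℂ)) *
        (K₀ * K₁ * K₂ * ρ (Y t₂) * (K₃ * ρ (Y t₃) * K₄)).trace := by
    intro Y; simp only [Matrix.mul_assoc]
  simp_rw [e3]
  rw [integral_weight_entry_step hw hρ hφ1 t₂ (insert t₃ S₀) n2 (K₀ * K₁ * K₂)
    (fun Y => K₃ * ρ (Y t₃) * K₄) (fun Y => (w (Y t₃) : ℂ) * ∏ u ∈ S₀, (w (Y u) : ℂ))
    (fun x y => CompactGroup.continuous_entry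
      ((continuous_const.mul (hρY t₃)).mul continuous_const) x y)
    (fun x y Y Y' h => by dsimp only; rw [h t₃ (by simp)])
    ((hwY t₃).mul (hprod S₀))
    (fun Y Y' h => by
      dsimp only
      rw [h t₃ (by simp), show (∏ u ∈ S₀, (w (Y u) : ℂ)) = ∏ u ∈ S₀, (w (Y' u) : ℂ) from
        hdepW S₀ (fun u hu => h u (by simp [hu]))])]
  -- Step 4: eliminate `t₃`
  have e4 : ∀ Y : Config A d G,
      (w (Y t₃) : ℂ) * (∏ u ∈ S₀, (w (Y u) : ℂ)) * (K₀ * K₁ * K₂ * (K₃ * ρ (Y t₃) * K₄)).trace =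
      (w (Y t₃) : ℂ) * (∏ u ∈ S₀, (w (Y u) : ℂ)) * (K₀ * K₁ * K₂ * K₃ * ρ (Y t₃) * K₄).trace := by
    intro Y; simp only [Matrix.mul_assoc]
  simp_rw [e4]
  rw [integral_weight_entry_step hw hρ hφ1 t₃ S₀ n3 (K₀ * K₁ * K₂ * K₃) (fun _ => K₄)
    (fun Y => ∏ u ∈ S₀, (w (Y u) : ℂ)) (fun x y => continuous_const) (fun x y Y Y' h => rfl)
    (hprod S₀) (hdepW S₀)]
  -- the remaining weights
  have hrest : ∫ Y, (∏ u ∈ S₀, (w (Y u) : ℂ)) * (K₀ * K₁ * K₂ * K₃ * K₄).trace ∂(productHaar A d G) =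
      (∫ k, (w k : ℂ) ∂(haarProbability G)) ^ S₀.card * (K₀ * K₁ * K₂ * K₃ * K₄).trace := by
    rw [integral_mul_const, integral_prod_weight hw]
  rw [hrest, hcard]
  ring

/-- **The slab integral.** For four distinct links `t₀, …, t₃` of the block `S` and constants
`a, b : Link → G`:
`∫ Re tr ρ(Y₀ Y₁ Y₂⁻¹ Y₃⁻¹) ∏_{t ∈ S} w(a_t Y_t⁻¹ b_t) dμ(Y) = z^{|S|-4} c⁴ Re tr ρ(b₀a₀b₁a₁a₂⁻¹b₂⁻¹a₃⁻¹b₃⁻¹)`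
(as complex numbers; `z = ∫ w dk`). In the application `Y₀ Y₁ Y₂⁻¹ Y₃⁻¹` is the holonomy of a
plaquette in the layer above a twisted slab and the right-hand word is the conjugate of the
holonomy of the plaquette below it. [folklore] -/
theorem slab_integral :
    ∫ Y, (((ρ (Y t₀ * Y t₁ * (Y t₂)⁻¹ * (Y t₃)⁻¹)).trace.re : ℝ) : ℂ) *
        ∏ t ∈ S, (w (a t * (Y t)⁻¹ * b t) : ℂ) ∂(productHaar A d G) =
      (∫ k, (w k : ℂ) ∂(haarProbability G)) ^ (S.card - 4) * c ^ 4 *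
        (((ρ (b t₀ * a t₀ * b t₁ * a t₁ * (a t₂)⁻¹ * (b t₂)⁻¹ * (a t₃)⁻¹ * (b t₃)⁻¹)).trace.re : ℝ) : ℂ) := by
  -- `c` is real... not needed: we compute with complex traces and take real parts at the end.
  -- Step A: substitute `Y_t ↦ b_t Y_t⁻¹ a_t` on `S`
  have hsub := measurePreserving_slabSubst S a b
  have hcont : Continuous fun Y : Config A d G =>
      (((ρ (Y t₀ * Y t₁ * (Y t₂)⁻¹ * (Y t₃)⁻¹)).trace.re : ℝ) : ℂ) *
        ∏ t ∈ S, (w (a t * (Y t)⁻¹ * b t) : ℂ) := by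
    refine (continuous_ofReal.comp (Complex.continuous_re.comp (hρ.comp ?_).matrix_trace)).mul
      (continuous_finsetProd _ fun t _ => continuous_ofReal.comp (hw.comp ?_))
    · exact (((continuous_apply t₀).mul (continuous_apply t₁)).mul (continuous_apply t₂).inv).mul
        (continuous_apply t₃).inv
    · exact (continuous_const.mul (continuous_apply t).inv).mul continuous_const
  rw [← integral_comp_eq_of_measurePreserving hsub hcont.measurable]
  -- the integrand after substitution
  have hA : ∀ Y : Config A d G,
      (((ρ (slabSubst S a b Y t₀ * slabSubst S a b Y t₁ * (slabSubst S a b Y t₂)⁻¹ *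
          (slabSubst S a b Y t₃)⁻¹)).trace.re : ℝ) : ℂ) *
        ∏ t ∈ S, (w (a t * (slabSubst S a b Y t)⁻¹ * b t) : ℂ) =
      (1 / 2 : ℂ) * ((∏ t ∈ S, (w (Y t) : ℂ)) *
        (ρ (b t₀) * ρ (Y t₀)⁻¹ * ρ (a t₀ * b t₁) * ρ (Y t₁)⁻¹ * ρ (a t₁ * (a t₂)⁻¹) * ρ (Y t₂) *
          ρ ((b t₂)⁻¹ * (a t₃)⁻¹) * ρ (Y t₃) * ρ ((b t₃)⁻¹)).trace) +
      (1 / 2 : ℂ) * ((∏ t ∈ S, (w (Y t) : ℂ)) *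
        (ρ (b t₃) * ρ (Y t₃)⁻¹ * ρ (a t₃ * b t₂) * ρ (Y t₂)⁻¹ * ρ (a t₂ * (a t₁)⁻¹) * ρ (Y t₁) *
          ρ ((b t₁)⁻¹ * (a t₀)⁻¹) * ρ (Y t₀) * ρ ((b t₀)⁻¹)).trace) := by
    intro Y
    have hW : ∏ t ∈ S, (w (a t * (slabSubst S a b Y t)⁻¹ * b t) : ℂ) = ∏ t ∈ S, (w (Y t) : ℂ) :=
      Finset.prod_congr rfl fun t ht => by rw [weightArg_slabSubst S a b Y ht]
    rw [hW, slabSubst_apply_of_mem S a b Y h₀, slabSubst_apply_of_mem S a b Y h₁,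
      slabSubst_apply_of_mem S a b Y h₂, slabSubst_apply_of_mem S a b Y h₃]
    -- `Re z = (z + conj z)/2` and `conj tr ρ(g) = tr ρ(g⁻¹)`
    set g : G := b t₀ * (Y t₀)⁻¹ * a t₀ * (b t₁ * (Y t₁)⁻¹ * a t₁) * (b t₂ * (Y t₂)⁻¹ * a t₂)⁻¹ *
      (b t₃ * (Y t₃)⁻¹ * a t₃)⁻¹ with hg
    have hre : (((ρ g).trace.re : ℝ) : ℂ) = (1 / 2 : ℂ) * ((ρ g).trace + (ρ g⁻¹).trace) := by
      rw [CompactGroup.trace_map_inv ρ hρ, Complex.add_conj]; push_cast; ring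
    have hg1 : ρ g = ρ (b t₀) * ρ (Y t₀)⁻¹ * ρ (a t₀ * b t₁) * ρ (Y t₁)⁻¹ * ρ (a t₁ * (a t₂)⁻¹) *
        ρ (Y t₂) * ρ ((b t₂)⁻¹ * (a t₃)⁻¹) * ρ (Y t₃) * ρ ((b t₃)⁻¹) := by
      rw [hg]; simp only [map_mul, mul_inv_rev, inv_inv, mul_assoc]
    have hg2 : ρ g⁻¹ = ρ (b t₃) * ρ (Y t₃)⁻¹ * ρ (a t₃ * b t₂) * ρ (Y t₂)⁻¹ * ρ (a t₂ * (a t₁)⁻¹) *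
        ρ (Y t₁) * ρ ((b t₁)⁻¹ * (a t₀)⁻¹) * ρ (Y t₀) * ρ ((b t₀)⁻¹) := by
      rw [hg]; simp only [map_mul, mul_inv_rev, inv_inv, mul_assoc]
    rw [hre, hg1, hg2]
    ring
  simp_rw [hA]
  have hI1 : Integrable (fun Y : Config A d G => (∏ t ∈ S, (w (Y t) : ℂ)) *
      (ρ (b t₀) * ρ (Y t₀)⁻¹ * ρ (a t₀ * b t₁) * ρ (Y t₁)⁻¹ * ρ (a t₁ * (a t₂)⁻¹) * ρ (Y t₂) *
        ρ ((b t₂)⁻¹ * (a t₃)⁻¹) * ρ (Y t₃) * ρ ((b t₃)⁻¹)).trace) (productHaar A d G) := by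
    refine integrable_config_of_continuous ((continuous_finsetProd _ fun t _ =>
      continuous_ofReal.comp (hw.comp (continuous_apply t))).mul (Continuous.matrix_trace ?_))
    have h0 : Continuous fun Y : Config A d G => ρ (Y t₀)⁻¹ := hρ.comp (continuous_apply t₀).inv
    have h1 : Continuous fun Y : Config A d G => ρ (Y t₁)⁻¹ := hρ.comp (continuous_apply t₁).inv
    have h2 : Continuous fun Y : Config A d G => ρ (Y t₂) := hρ.comp (continuous_apply t₂)
    have h3 : Continuous fun Y : Config A d G => ρ (Y t₃) := hρ.comp (continuous_apply t₃)
    exact (((((((continuous_const.mul h0).mul continuous_const).mul h1).mul continuous_const).mul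
      h2).mul continuous_const).mul h3).mul continuous_const
  have hI2 : Integrable (fun Y : Config A d G => (∏ t ∈ S, (w (Y t) : ℂ)) *
      (ρ (b t₃) * ρ (Y t₃)⁻¹ * ρ (a t₃ * b t₂) * ρ (Y t₂)⁻¹ * ρ (a t₂ * (a t₁)⁻¹) * ρ (Y t₁) *
        ρ ((b t₁)⁻¹ * (a t₀)⁻¹) * ρ (Y t₀) * ρ ((b t₀)⁻¹)).trace) (productHaar A d G) := by
    refine integrable_config_of_continuous ((continuous_finsetProd _ fun t _ =>
      continuous_ofReal.comp (hw.comp (continuous_apply t))).mul (Continuous.matrix_trace ?_))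
    have h0 : Continuous fun Y : Config A d G => ρ (Y t₀) := hρ.comp (continuous_apply t₀)
    have h1 : Continuous fun Y : Config A d G => ρ (Y t₁) := hρ.comp (continuous_apply t₁)
    have h2 : Continuous fun Y : Config A d G => ρ (Y t₂)⁻¹ := hρ.comp (continuous_apply t₂).inv
    have h3 : Continuous fun Y : Config A d G => ρ (Y t₃)⁻¹ := hρ.comp (continuous_apply t₃).inv
    exact (((((((continuous_const.mul h3).mul continuous_const).mul h2).mul continuous_const).mul
      h1).mul continuous_const).mul h0).mul continuous_const
  rw [integral_add (hI1.const_mul _) (hI2.const_mul _), integral_const_mul, integral_const_mul,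
    integral_prod_weight_mul_trace ρ hw hinv hc hρ S h₀ h₁ h₂ h₃ h01 h02 h03 h12 h13 h23,
    integral_prod_weight_mul_trace ρ hw hinv hc hρ S h₃ h₂ h₁ h₀ h23.symm h13.symm h03.symm
      h12.symm h02.symm h01.symm]
  -- collect: both words are `ρ` of the word and of its inverse
  set g₀ : G := b t₀ * a t₀ * b t₁ * a t₁ * (a t₂)⁻¹ * (b t₂)⁻¹ * (a t₃)⁻¹ * (b t₃)⁻¹ with hg₀
  have hk1 : ρ (b t₀) * ρ (a t₀ * b t₁) * ρ (a t₁ * (a t₂)⁻¹) * ρ ((b t₂)⁻¹ * (a t₃)⁻¹) * ρ ((b t₃)⁻¹)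
      = ρ g₀ := by
    rw [hg₀]; simp only [map_mul, mul_assoc]
  have hk2 : ρ (b t₃) * ρ (a t₃ * b t₂) * ρ (a t₂ * (a t₁)⁻¹) * ρ ((b t₁)⁻¹ * (a t₀)⁻¹) * ρ ((b t₀)⁻¹)
      = ρ g₀⁻¹ := by
    rw [hg₀]; simp only [map_mul, mul_inv_rev, inv_inv, mul_assoc]
  rw [hk1, hk2, CompactGroup.trace_map_inv ρ hρ]
  have hre : (((ρ g₀).trace.re : ℝ) : ℂ) = (1 / 2 : ℂ) * ((ρ g₀).trace + conj (ρ g₀).trace) := by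
    rw [Complex.add_conj]; push_cast; ring
  rw [hre]
  ring

end Slab

/-! ## The slab integral with frozen neighbours (Fubini over the block) -/

section Conditional

variable {w : G → ℝ} (hw : Continuous w) (hinv : ∀ k, w k⁻¹ = w k) {c : ℂ}
  (hc : wAvg ρ w = c • (1 : Matrix (Fin N) (Fin N) ℂ)) (hρ : Continuous ρ)
  (C : Finset (Link A d)) (a b : Link A d → Config A d G → G)
  (ha : ∀ t, Continuous (a t)) (hb : ∀ t, Continuous (b t))
  (haC : ∀ t, DependsOn (a t) ((Cᶜ : Finset (Link A d)) : Set (Link A d)))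
  (hbC : ∀ t, DependsOn (b t) ((Cᶜ : Finset (Link A d)) : Set (Link A d)))
  (g : Config A d G → ℂ) (hg : Continuous g) (hgC : DependsOn g ((Cᶜ : Finset (Link A d)) : Set (Link A d)))
  {t₀ t₁ t₂ t₃ : Link A d} (h₀ : t₀ ∈ C) (h₁ : t₁ ∈ C) (h₂ : t₂ ∈ C) (h₃ : t₃ ∈ C)
  (h01 : t₀ ≠ t₁) (h02 : t₀ ≠ t₂) (h03 : t₀ ≠ t₃) (h12 : t₁ ≠ t₂) (h13 : t₁ ≠ t₃) (h23 : t₂ ≠ t₃)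
include hw hinv hc hρ ha hb haC hbC hg hgC h₀ h₁ h₂ h₃ h01 h02 h03 h12 h13 h23

omit [Fintype A] [Group G] [IsTopologicalGroup G] [CompactSpace G] [MeasurableSpace G] [BorelSpace G]
  [SecondCountableTopology G] hw hinv hc hρ ha hb haC hbC hg hgC h₀ h₁ h₂ h₃ h01 h02 h03 h12 h13 h23 in
/-- `splice` is continuous. [folklore] -/
theorem continuous_splice (C : Finset (Link A d)) :
    Continuous (Literature.MathematicalPhysics.QuantumFieldTheory.LatticeRP.splice (G := G) C) := by
  refine continuous_pi fun t => ?_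
  by_cases ht : t ∈ C
  · simp only [Literature.MathematicalPhysics.QuantumFieldTheory.LatticeRP.splice_apply, ht, if_true]
    exact (continuous_apply t).comp continuous_snd
  · simp only [Literature.MathematicalPhysics.QuantumFieldTheory.LatticeRP.splice_apply, ht, if_false]
    exact (continuous_apply t).comp continuous_fst

/-- **The slab integral with frozen neighbours.** Let the weights on the block `C` be
`w(a_t(U) U_t⁻¹ b_t(U))` with `a_t, b_t` continuous functions of the configuration OFF the block, and
let `g` be continuous and depend only on the configuration off the block. Then for four distinct
links `t₀, …, t₃ ∈ C`,
`∫ g(U) Re tr ρ(U₀ U₁ U₂⁻¹ U₃⁻¹) ∏_{t∈C} w(a_t(U) U_t⁻¹ b_t(U)) dμ(U)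
   = z^{|C|-4} c⁴ ∫ g(U) Re tr ρ(b₀a₀b₁a₁a₂⁻¹b₂⁻¹a₃⁻¹b₃⁻¹)(U) dμ(U)`
(Fubini over the block via `LatticeRP.splice`, then `slab_integral` with the neighbours frozen).
[folklore] -/
theorem slab_integral_frozen :
    ∫ U, g U * (((ρ (U t₀ * U t₁ * (U t₂)⁻¹ * (U t₃)⁻¹)).trace.re : ℝ) : ℂ) *
        ∏ t ∈ C, (w (a t U * (U t)⁻¹ * b t U) : ℂ) ∂(productHaar A d G) =
      (∫ k, (w k : ℂ) ∂(haarProbability G)) ^ (C.card - 4) * c ^ 4 *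
        ∫ U, g U * (((ρ (b t₀ U * a t₀ U * b t₁ U * a t₁ U * (a t₂ U)⁻¹ * (b t₂ U)⁻¹ *
          (a t₃ U)⁻¹ * (b t₃ U)⁻¹)).trace.re : ℝ) : ℂ) ∂(productHaar A d G) := by
  set spl := Literature.MathematicalPhysics.QuantumFieldTheory.LatticeRP.splice (G := G) C with hspl
  set h : Config A d G → ℂ := fun U => g U * (((ρ (U t₀ * U t₁ * (U t₂)⁻¹ * (U t₃)⁻¹)).trace.re : ℝ) : ℂ) *
    ∏ t ∈ C, (w (a t U * (U t)⁻¹ * b t U) : ℂ) with hh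
  have hU : ∀ t, Continuous fun U : Config A d G => U t := fun t => continuous_apply t
  have hhc : Continuous h := by
    refine (hg.mul (continuous_ofReal.comp (Complex.continuous_re.comp (hρ.comp ?_).matrix_trace))).mul
      (continuous_finsetProd _ fun t _ => continuous_ofReal.comp (hw.comp ?_))
    · exact (((hU t₀).mul (hU t₁)).mul (hU t₂).inv).mul (hU t₃).inv
    · exact ((ha t).mul (hU t).inv).mul (hb t)
  -- Fubini over the block
  have hsp : MeasurePreserving spl ((productHaar A d G).prod (productHaar A d G)) (productHaar A d G) := by
    unfold productHaar
    exact Literature.MathematicalPhysics.QuantumFieldTheory.LatticeRP.measurePreserving_splice _ C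
  have h1 : ∫ U, h U ∂(productHaar A d G) =
      ∫ U, ∫ Y, h (spl (U, Y)) ∂(productHaar A d G) ∂(productHaar A d G) := by
    rw [← integral_comp_eq_of_measurePreserving hsp hhc.measurable, integral_prod]
    exact ((hhc.comp (continuous_splice C)).integrable_of_hasCompactSupport
      (HasCompactSupport.of_compactSpace _))
  -- the integrand on the block, neighbours frozen at `U`
  have h2 : ∀ U Y : Config A d G, h (spl (U, Y)) =
      g U * ((((ρ (Y t₀ * Y t₁ * (Y t₂)⁻¹ * (Y t₃)⁻¹)).trace.re : ℝ) : ℂ) *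
        ∏ t ∈ C, (w (a t U * (Y t)⁻¹ * b t U) : ℂ)) := by
    intro U Y
    have hon : ∀ t ∈ C, spl (U, Y) t = Y t := fun t ht => by
      rw [hspl, Literature.MathematicalPhysics.QuantumFieldTheory.LatticeRP.splice_apply, if_pos ht]
    have hoff : ∀ t ∈ ((Cᶜ : Finset (Link A d)) : Set (Link A d)), spl (U, Y) t = U t := fun t ht => by
      have ht' : t ∉ C := by simpa using ht
      rw [hspl, Literature.MathematicalPhysics.QuantumFieldTheory.LatticeRP.splice_apply, if_neg ht']
    rw [hh]
    simp only []
    rw [hgC hoff, hon t₀ h₀, hon t₁ h₁, hon t₂ h₂, hon t₃ h₃, mul_assoc]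
    congr 2
    exact Finset.prod_congr rfl fun t ht => by rw [haC t hoff, hbC t hoff, hon t ht]
  have h3 : ∀ U : Config A d G, ∫ Y, h (spl (U, Y)) ∂(productHaar A d G) =
      (∫ k, (w k : ℂ) ∂(haarProbability G)) ^ (C.card - 4) * c ^ 4 *
        (g U * (((ρ (b t₀ U * a t₀ U * b t₁ U * a t₁ U * (a t₂ U)⁻¹ * (b t₂ U)⁻¹ *
          (a t₃ U)⁻¹ * (b t₃ U)⁻¹)).trace.re : ℝ) : ℂ)) := by
    intro U
    simp_rw [h2 U]
    rw [integral_const_mul, slab_integral ρ hw hinv hc hρ C (fun t => a t U) (fun t => b t U) h₀ h₁ h₂ h₃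
      h01 h02 h03 h12 h13 h23]
    ring
  rw [h1]
  simp_rw [h3]
  rw [integral_const_mul]

end Conditional

end TwistedSlab

end Summit.QuantumFields.GaugeBoot

end
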